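import Mathlib
import HarnessLib
import Summits.NavierStokesRegularity.NavierStokesRegularity.Theorems.UnthreadedDoorNetFluxStratumReduction

/-!
# Route `UnthreadedDoor`, crux `PoloidalLiouville` (stmt-NavierStokesRegularity-1222), WALL W1 — netflux line OVER A STRATUM PREDICATE:
# S⁺ ⇒ stratum re-run `NetFluxWindowDecayOn S → ScalarLiouvilleTypeIOn S`

ns-idea-14 g5's second-stratum design (crux idea «height-head», 2026-08-28T23:22Z): the netflux chain typed ONCE over a stratum predicate
`S : (ℝ → E3 → E3) → E3 → (ℝ → E3 → ℝ) → ℝ → Prop`.  In ARM A's landed reduction (`unimodalScalarLiouvilleTypeI_of_netFluxWindowDecay`,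
p660934, ns-exp-scalarLiouville g3; NF-2 `typeIVorticityBound` and NF-5 inside) unimodality is used ONLY as the argument handed to the
window-decay statement; this file is that proof VERBATIM with the hypothesis generalized (credit: ARM A; helper lemmas of
`…NetFluxStratumReduction` BY NAME):

* `scalarLiouvilleTypeIOn_of_netFluxWindowDecayOn S` — for EVERY stratum predicate `S`: window decay on the stratum ⇒ scalar Liouville in
  the Type-I class on the stratum (bodies UNFOLDED; the line's `…On S` Props close by name).

HONEST LABEL: bookkeeping for future strata of W1; `PoloidalLiouville` (1222), C⁻, W1 and the summit stay OPEN; NO NS regularity statement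
is proved.  `--supports stmt-NavierStokesRegularity-1222 --as helper`.  (Import note: via `…StratumReduction` this sits in the
`TypeILiouville` Theorems cone, as p660934/p675773.)  [folklore]
-/

-- the summit and its single sub-problem share the name (CONVENTIONS §1)
set_option linter.dupNamespace false

noncomputable section

namespace Summit.NavierStokesRegularity.NavierStokesRegularity.Theorems.PoloidalLiouville.NetFlux

open MeasureTheory Filter Set Function Metric
open scoped Topology RealInnerProductSpace InnerProductSpace
open Literature.Analysis Literature.Analysis.FluidPDE

/-- **S⁺ ⇒ the stratum statement, over a stratum predicate**: for every `S`, window decay of the cumulative net flux on the stratum implies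
scalar Liouville in the Type-I class on the stratum (ancient ⇒ `t₁ → −∞` ⇒ `∫₀ᴿ netFlux ≤ 0` ⇒ `T(t)` constant on spheres ⇒ radial
gradient; ARM A's p660934 proof verbatim, stratum hypothesis passed to the window-decay statement only).  No NS statement is involved.
[folklore] -/
theorem scalarLiouvilleTypeIOn_of_netFluxWindowDecayOn (S : (ℝ → E3 → E3) → E3 → (ℝ → E3 → ℝ) → ℝ → Prop)
    (hS : ∀ C : ℝ, 0 ≤ C → ∃ lam > (0 : ℝ), ∃ A : ℝ,
      ∀ (v : ℝ → E3 → E3) (x₀ : E3) (T : ℝ → E3 → ℝ) (C₁ t₀ : ℝ), t₀ < 0 →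
      ContDiffOn ℝ (⊤ : ℕ∞) (uncurry v) (Ioo t₀ 0 ×ˢ univ) →
      ContDiffOn ℝ (⊤ : ℕ∞) (uncurry T) (Ioo t₀ 0 ×ˢ ({x₀}ᶜ : Set E3)) →
      (∀ t ∈ Ioo t₀ 0, ∀ x, ‖v t x‖ ≤ C / Real.sqrt (-t)) →
      (∀ t ∈ Ioo t₀ 0, ∀ x, ‖curl (v t) x‖ ≤ C₁ / (-t)) →
      (∀ t ∈ Ioo t₀ 0, ∀ x, curl (v t) x = cross (gradient (T t) x) (x - x₀)) →
      CurledLaw v x₀ T (Ioo t₀ 0) →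
      (∀ t ∈ Ioo t₀ 0, S v x₀ T t) →
      ∀ t₁ t R : ℝ, t₀ < t₁ → t₁ ≤ t → t < 0 → 0 < R →
        ∫ r in Ioo 0 R, netFlux (T t) x₀ r
          ≤ A * C₁ * (1 + R / Real.sqrt (-t)) ^ 3 * (t / t₁) ^ lam) :
    ∀ (v : ℝ → E3 → E3) (x₀ : E3) (T : ℝ → E3 → ℝ),
      (∃ C : ℝ, HasTypeITimeDecay C v) →
      IsBoundedAncientMildSolution 1 v →
      (∀ t < 0, AEStronglyMeasurable (v t) volume) →
      ContDiffOn ℝ (⊤ : ℕ∞) (uncurry v) (Iio 0 ×ˢ univ) →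
      ContDiffOn ℝ (⊤ : ℕ∞) (uncurry T) (Iio 0 ×ˢ ({x₀}ᶜ : Set E3)) →
      (∃ C : ℝ, ∀ t < 0, ∀ x, |T t x| ≤ C) →
      (∀ t < 0, ∀ x, curl (v t) x = cross (gradient (T t) x) (x - x₀)) →
      CurledLaw v x₀ T (Iio 0) →
      (∀ t < 0, S v x₀ T t) →
      ∀ t < 0, ∀ x, cross (gradient (T t) x) (x - x₀) = 0 := by
  intro v x₀ T hC hB _hmeas hsv hsT hTb hrep hE hSt t ht x
  obtain ⟨C, hCv⟩ := hC
  obtain ⟨CT, hCT⟩ := hTb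
  -- `0 ≤ C`
  have hC0 : 0 ≤ C := by
    have h := hCv (-1) (by norm_num) 0
    rw [neg_neg, Real.sqrt_one, div_one] at h
    exact (norm_nonneg _).trans h
  obtain ⟨lam, hlam, A, hA⟩ := hS C hC0
  obtain ⟨C₁, hC₁⟩ := NetFlux.typeIVorticityBound v C hB hCv hsv
  -- ### the window bound at time `t`, for every `t₁ ≤ t` and `R > 0`
  have hwin : ∀ t₁ : ℝ, t₁ ≤ t → ∀ R : ℝ, 0 < R →
      ∫ r in Ioo 0 R, netFlux (T t) x₀ r ≤ A * C₁ * (1 + R / Real.sqrt (-t)) ^ 3 * (t / t₁) ^ lam := by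
    intro t₁ ht₁ R hR
    have ht₀ : t₁ - 1 < 0 := by linarith
    have hsub : Ioo (t₁ - 1) 0 ⊆ Iio (0 : ℝ) := Ioo_subset_Iio_self
    exact hA v x₀ T C₁ (t₁ - 1) ht₀ (hsv.mono (prod_mono hsub le_rfl)) (hsT.mono (prod_mono hsub le_rfl))
      (fun s hs => hCv s hs.2) (fun s hs => hC₁ s hs.2) (fun s hs => hrep s hs.2) (fun s hs => hE s (hsub hs))
      (fun s hs => hSt s hs.2) t₁ t R (by linarith) ht₁ ht hR
  -- ### letting `t₁ → −∞`: the integrals are `≤ 0`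
  have hint : ∀ R : ℝ, 0 < R → ∫ r in Ioo 0 R, netFlux (T t) x₀ r ≤ 0 := by
    intro R hR
    set D : ℝ := A * C₁ * (1 + R / Real.sqrt (-t)) ^ 3 with hD
    refine le_of_forall_pos_le_add fun δ hδ => ?_
    rw [zero_add]
    -- choose `t₁ ≤ t` with `|D| (t/t₁)^λ ≤ δ`
    set m : ℝ := min ((δ / (|D| + 1)) ^ (1 / lam)) 1 with hm
    have hq0 : 0 < δ / (|D| + 1) := div_pos hδ (by positivity)
    have hm0 : 0 < m := lt_min (Real.rpow_pos_of_pos hq0 _) one_pos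
    have hm1 : m ≤ 1 := min_le_right _ _
    set t₁ : ℝ := t / m with ht₁
    have ht₁t : t₁ ≤ t := by
      rw [ht₁, div_le_iff₀ hm0]; nlinarith
    have hquot : t / t₁ = m := by
      rw [ht₁, div_div_eq_mul_div, mul_comm, mul_div_assoc, div_self ht.ne, mul_one]
    have h := hwin t₁ ht₁t R hR
    rw [hquot, ← hD] at h
    have hmpow : m ^ lam ≤ δ / (|D| + 1) := by
      have h1 : m ^ lam ≤ ((δ / (|D| + 1)) ^ (1 / lam)) ^ lam :=
        Real.rpow_le_rpow hm0.le (min_le_left _ _) hlam.le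
      rw [← Real.rpow_mul hq0.le, one_div_mul_cancel hlam.ne', Real.rpow_one] at h1
      exact h1
    have hmpow0 : 0 ≤ m ^ lam := Real.rpow_nonneg hm0.le _
    calc ∫ r in Ioo 0 R, netFlux (T t) x₀ r ≤ D * m ^ lam := h
      _ ≤ |D| * m ^ lam := by gcongr; exact le_abs_self D
      _ ≤ |D| * (δ / (|D| + 1)) := by gcongr
      _ ≤ δ := by
          rw [mul_div_assoc']
          rw [div_le_iff₀ (by positivity)]
          nlinarith [abs_nonneg D]
  -- ### the density `r ↦ r·osc` is continuous, nonnegative and bounded on `(0,R)`: it vanishes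
  have hTc : ContinuousOn (T t) {x₀}ᶜ :=
    (hsT.continuousOn.comp (continuous_const.prodMk continuous_id).continuousOn fun y hy =>
      mk_mem_prod (mem_Iio.2 ht) hy)
  have hTb' : ∀ y, |T t y| ≤ CT := fun y => hCT t ht y
  have hg0 : ∀ r, 0 < r → 0 ≤ netFlux (T t) x₀ r := fun r hr =>
    mul_nonneg hr.le (sphOsc_nonneg hTb' x₀ hr.le)
  have hgb : ∀ R, 0 < R → ∃ M, ∀ r ∈ Ioo 0 R, |netFlux (T t) x₀ r| ≤ M := by
    intro R hR
    refine ⟨R * (2 * CT), fun r hr => ?_⟩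
    rw [abs_of_nonneg (hg0 r hr.1)]
    unfold netFlux
    have hosc : sphOsc (T t) x₀ r ≤ 2 * CT := by
      obtain ⟨y, hy⟩ := sphere_nonempty x₀ hr.1.le
      have h := sphInf_le_le_sphSup hTb' x₀ hy
      -- `sSup ≤ CT`, `−CT ≤ sInf`
      have hab : BddAbove (T t '' Metric.sphere x₀ r) := ⟨CT, by
        rintro _ ⟨z, -, rfl⟩; exact le_of_abs_le (hTb' z)⟩
      have hbe : BddBelow (T t '' Metric.sphere x₀ r) := ⟨-CT, by
        rintro _ ⟨z, -, rfl⟩; exact neg_le_of_abs_le (hTb' z)⟩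
      have hne : (T t '' Metric.sphere x₀ r).Nonempty := ⟨_, mem_image_of_mem _ hy⟩
      have hsup : sphSup (T t) x₀ r ≤ CT := csSup_le hne (by rintro _ ⟨z, -, rfl⟩; exact le_of_abs_le (hTb' z))
      have hinf : -CT ≤ sphInf (T t) x₀ r := le_csInf hne (by rintro _ ⟨z, -, rfl⟩; exact neg_le_of_abs_le (hTb' z))
      unfold sphOsc; linarith
    exact mul_le_mul hr.2.le hosc (sphOsc_nonneg hTb' x₀ hr.1.le) hR.le
  have hzero := eq_zero_of_setIntegral_nonpos hg0 (continuousOn_netFlux hTc) hgb hint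
  -- ### `T t` is constant on every sphere about `x₀`
  have hrad : ∀ y z : E3, ‖y - x₀‖ = ‖z - x₀‖ → T t y = T t z := by
    intro y z hyz
    rcases (norm_nonneg (y - x₀)).eq_or_lt with h0 | hpos
    · have hy : y = x₀ := by rw [← sub_eq_zero, ← norm_eq_zero]; exact h0.symm
      have hz : z = x₀ := by rw [← sub_eq_zero, ← norm_eq_zero, ← hyz]; exact h0.symm
      rw [hy, hz]
    · have hosc : sphOsc (T t) x₀ ‖y - x₀‖ = 0 := by
        have h := hzero ‖y - x₀‖ hpos
        unfold netFlux at h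
        rcases mul_eq_zero.1 h with h | h
        · exact absurd h hpos.ne'
        · exact h
      exact sphere_const_of_sphOsc_eq_zero hTb' x₀ hosc (mem_sphere_iff_norm.2 rfl)
        (mem_sphere_iff_norm.2 hyz.symm)
  -- ### radial gradient
  have hTd : DifferentiableOn ℝ (T t) {x₀}ᶜ := by
    have h1 : ContDiffOn ℝ (⊤ : ℕ∞) (T t) {x₀}ᶜ :=
      hsT.comp (contDiffOn_const.prodMk contDiffOn_id) fun y hy => mk_mem_prod (mem_Iio.2 ht) hy
    exact h1.differentiableOn (by simp)
  exact cross_gradient_eq_zero_of_sphere_const hTd hrad x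


end Summit.NavierStokesRegularity.NavierStokesRegularity.Theorems.PoloidalLiouville.NetFlux

end
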